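import Mathlib
import HarnessLib
import Summits.ValiantsHypothesis.ValiantsHypothesis.Theses.MonotoneRestoration
import Literature.Combinatorics.Enumerative.PermPrescribed

/-!
# ValiantsHypothesis / MonotoneRestoration — `MonotoneRestorationQP`, line `Sketch`, stub S1

Support file for crux item `stmt-ValiantsHypothesis-15886`
(`Summit.ValiantsHypothesis.ValiantsHypothesis.Theses.MonotoneRestoration.MonotoneRestorationQP`),
line `Sketch`, stub `stub_cosetCount` (coset counting).

In `Sym(Fin n)`, the permutations fixing `Kᵢ` pointwise and agreeing on `Kⱼ` with a map `l` that is
injective on `Kⱼ`, the identity on `Kⱼ ∩ Kᵢ` and sends `Kⱼ ∖ Kᵢ` outside `Kᵢ`, number exactly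
`(n - |Kᵢ ∪ Kⱼ|)!`.  This is the counting fact behind the averaging constant of the coset-block
symmetrisation (`stub_supportSymmetrisation` of the same line takes it as a hypothesis).

Proof: the filtered set is `Literature.Combinatorics.Enumerative.permsPrescribed (Kᵢ ∪ Kⱼ) f` for
the glued map `f x = if x ∈ Kᵢ then x else l x` (membership uses `l = id` on `Kⱼ ∩ Kᵢ`); `f` is
injective on `Kᵢ ∪ Kⱼ` by the three hypotheses (a point of `Kᵢ` and a point of `Kⱼ ∖ Kᵢ` have
distinct images because `l` sends the latter outside `Kᵢ`); conclude with
`Literature.Combinatorics.Enumerative.card_permsPrescribed` and `Fintype.card_fin`.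

No new definitions: the glued map is written as a literal `fun x => if x ∈ Ki then x else l x`.
-/

-- `Summit.ValiantsHypothesis.ValiantsHypothesis.…` is the tree's mandated single-conjunct layout
-- (Sub = Summit), so the duplicated namespace component is intended.
set_option linter.dupNamespace false

namespace Summit.ValiantsHypothesis.ValiantsHypothesis.Theorems

open Literature.Combinatorics.Enumerative

/-- **Membership.** A permutation fixes `Ki` pointwise and agrees with `l` on `Kj` iff it agrees
with the glued map `x ↦ if x ∈ Ki then x else l x` on `Ki ∪ Kj`, provided `l` is the identity on
`Kj ∩ Ki`. [folklore] -/
theorem cosetCount_filter_eq_permsPrescribed {n : ℕ} (Ki Kj : Finset (Fin n)) (l : Fin n → Fin n)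
    (hfix : ∀ x ∈ Kj, x ∈ Ki → l x = x) :
    (Finset.univ.filter (fun σ : Equiv.Perm (Fin n) =>
        (∀ x ∈ Ki, σ x = x) ∧ (∀ x ∈ Kj, σ x = l x))) =
      permsPrescribed (Ki ∪ Kj) (fun x => if x ∈ Ki then x else l x) := by
  ext σ
  simp only [Finset.mem_filter, Finset.mem_univ, true_and, mem_permsPrescribed, Finset.mem_union]
  constructor
  · rintro ⟨hKi, hKj⟩ x hx
    by_cases hxi : x ∈ Ki
    · rw [if_pos hxi, hKi x hxi]
    · rw [if_neg hxi, hKj x (hx.resolve_left hxi)]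
  · intro h
    refine ⟨fun x hx => ?_, fun x hx => ?_⟩
    · have hx' := h x (Or.inl hx)
      rwa [if_pos hx] at hx'
    · by_cases hxi : x ∈ Ki
      · have hx' := h x (Or.inl hxi)
        rw [if_pos hxi] at hx'
        rw [hx', hfix x hx hxi]
      · have hx' := h x (Or.inr hx)
        rwa [if_neg hxi] at hx'

/-- **Injectivity of the glued map.** If `l` is injective on `Kj` and sends `Kj ∖ Ki` outside `Ki`,
then `x ↦ if x ∈ Ki then x else l x` is injective on `Ki ∪ Kj`. [folklore] -/
theorem cosetCount_glue_injOn {n : ℕ} (Ki Kj : Finset (Fin n)) (l : Fin n → Fin n)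
    (hinj : Set.InjOn l ↑Kj) (hout : ∀ x ∈ Kj, x ∉ Ki → l x ∉ Ki) :
    Set.InjOn (fun x => if x ∈ Ki then x else l x) ↑(Ki ∪ Kj) := by
  intro x hx y hy hxy
  rw [Finset.coe_union, Set.mem_union, Finset.mem_coe, Finset.mem_coe] at hx hy
  simp only at hxy
  by_cases hxi : x ∈ Ki <;> by_cases hyi : y ∈ Ki
  · rwa [if_pos hxi, if_pos hyi] at hxy
  · rw [if_pos hxi, if_neg hyi] at hxy
    exact absurd (hxy ▸ hxi) (hout y (hy.resolve_left hyi) hyi)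
  · rw [if_neg hxi, if_pos hyi] at hxy
    exact absurd (hxy ▸ hyi) (hout x (hx.resolve_left hxi) hxi)
  · rw [if_neg hxi, if_neg hyi] at hxy
    exact hinj (hx.resolve_left hxi) (hy.resolve_left hyi) hxy

/-- **S1 — coset counting** (line `Sketch` of crux `MonotoneRestorationQP`, stub `stub_cosetCount`).
In `Sym(Fin n)`, the permutations fixing `Kᵢ` pointwise and agreeing on `Kⱼ` with a map `l` that is
injective on `Kⱼ`, the identity on `Kⱼ ∩ Kᵢ` and sends `Kⱼ ∖ Kᵢ` outside `Kᵢ`, number exactly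
`(n - |Kᵢ ∪ Kⱼ|)!`: they are the extensions of the injective partial map on `Kᵢ ∪ Kⱼ` glued from
`id` and `l` (`Literature.Combinatorics.Enumerative.card_permsPrescribed`). [folklore] -/
theorem stub_cosetCount : ∀ (n : ℕ) (Ki Kj : Finset (Fin n)) (l : Fin n → Fin n),
    Set.InjOn l ↑Kj → (∀ x ∈ Kj, x ∈ Ki → l x = x) → (∀ x ∈ Kj, x ∉ Ki → l x ∉ Ki) →
    (Finset.univ.filter (fun σ : Equiv.Perm (Fin n) =>
        (∀ x ∈ Ki, σ x = x) ∧ (∀ x ∈ Kj, σ x = l x))).card = Nat.factorial (n - (Ki ∪ Kj).card) := by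
  intro n Ki Kj l hinj hfix hout
  rw [cosetCount_filter_eq_permsPrescribed Ki Kj l hfix,
    card_permsPrescribed (Ki ∪ Kj) (cosetCount_glue_injOn Ki Kj l hinj hout), Fintype.card_fin]

end Summit.ValiantsHypothesis.ValiantsHypothesis.Theorems
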